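import Literature.NumberTheory.Automorphic.ArchRankOneJumpZeroCayley         -- ★ p850055 (this seat): `integral_comp_conj_transport`, `tendsto_std_of_eq`; brings ★ p849935 (K0±)-U11 and ★ `UnitaryGroupFormTransport`
import HarnessLib

/-!
# The one-sided values at the central wall ON THE GROUP `U(e₀,e₁)`, `e₀e₁ < 0` (general real weights): the order-0 twin of ★ (R1G)
# (Varadarajan 1989 §6.4 Lemma 21 (c), Thm 23; Rogawski 1990 §8.2 p. 119; Platonov–Rapinchuk 1994 §2.3)

Topic `NumberTheory/Automorphic`; namespace `Literature.NumberTheory.Automorphic.UnitaryGroup`.  THEOREMS ONLY (no `def`, no instance, no notation, no axiom, no named fact, no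
`sorry`).  Cell `pub/hodgecm-mathlib`, line LH3 (closer stub `stub_N9`, crux H413 = `stmt-HodgeConjecture-24833`), DIRECT ROAD brick **(K0±)-U11-WEIGHTS** (LH10-p02 (g3) 2026-09-02,
sequel (a) to ★ p849935 ∕ ★ p850055): the input shape of the `G′`-side descent (J-DESC) at a singular elliptic point, whose `U(1,1)`-block is `U(σ_w diag(α_i, α_j))` with REAL weights
of opposite signs — the carrier `unitaryGroupOfForm (starRingEnd ℂ) ((diagonal a).map σ)` of ★ (R1G) `exists_tendsto_deriv_two_sin_smul_orbitalIntegral` (the DERIVATIVE limit);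
this file gives the one-sided VALUES and the order-0 jump on the same carrier.

THE MATHEMATICS.  `e_i = re σ(a_i)`, `e₀e₁ < 0`; `T = diag(√|e₀|, √|e₁|)` satisfies `σ(T)ᵀ J T = diag(e₀, e₁)` with `J = diag(sign e₀, sign e₁) ∈ {±diag(1,−1)}`, `U(−J) = U(J)`, so
`h′ ↦ T h′ T⁻¹ : U(diag(e₀,e₁)) ≃ₜ* U(diag(1,−1))` (★ `unitaryGroupOfFormCongrOfEq`) FIXES the circle torus (`T` diagonal).  Transporting a Haar measure `μ₂` on `U(diag(e₀,e₁))`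
forward and the test function to `X ↦ f(T⁻¹ X T)` (★ `integral_comp_conj_transport`, p850055), ★ (K0±)-U11 gives: ONE `C₁ > 0` per `μ₂` with, for every continuous compactly
supported `f` and `z ∈ S¹`, `2 sin ψ · ∫_{U(diag(e₀,e₁))} f(h·diag(z e^{iψ}, z e^{−iψ})·h⁻¹) dμ₂ → C₁ • ∫_{τ>0,θ} f(T⁻¹ (z·1 + τ·diag(iz,−iz) + τ·W_i θ) T)` (`ψ → 0⁺`), and
`→ −C₁ • ∫ f(T⁻¹ (z·1 + τ·diag(−iz,iz) + τ·W_{−i} θ) T)` (`ψ → 0⁻`) — the half-cones of `𝔲(e₀,e₁)` at `z·1` (`Ad(T⁻¹)` of ★ p849935's, left un-multiplied).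
HONEST LABEL: HC_CM is proved only modulo the 7 printed citations (2 remaining: hLiu418 = stmt-HodgeConjecture-24832, h413 = stmt-HodgeConjecture-24833) until rung 0 closes;
frame bookkeeping over ★ p849935 ∕ p850055, count-neutral, pays nothing by itself.

WHAT IS PROVED.  `circleDiagonal_mem_unitaryGroupOfForm_diagonal_map_weights` (the torus membership, public so consumers can spell the torus point), the frame core
**`tendsto_two_sin_smul_orbitalIntegral_nhdsGT_nhdsLT_of_formCongr`** (diagonal congruence `σ(T)ᵀ J T = H`, `U(J) = U(diag(1,−1))`, explicit matrices `Tm = ↑T`, `Ti = ↑T⁻¹` in the values),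
the head **`exists_tendsto_two_sin_smul_orbitalIntegral_nhdsGT_nhdsLT_weights (σ) (a) (hreal) (hsgn) (μ₂)`** and **`exists_hasOneSidedJump_two_sin_mul_orbitalIntegral_weights`** (`E = ℂ`).

## References
* [Varadarajan1989] V. S. Varadarajan, *An Introduction to Harmonic Analysis on Semisimple Lie Groups*, Cambridge Stud. Adv. Math. 16 (1989), §6.4 Lemma 21 (c), Thm 23.
* [Rogawski1990] J. D. Rogawski, *Automorphic Representations of Unitary Groups in Three Variables*, Ann. of Math. Stud. 123 (1990), §8.2 Prop. 8.2.1 pp. 118–119, §3.8 p. 30.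
* [PlatonovRapinchuk1994] V. Platonov, A. Rapinchuk, *Algebraic Groups and Number Theory* (1994), §2.3 (unitary groups of hermitian forms, change of frame).
* [Shelstad1979] D. Shelstad, *Characters and inner forms of a quasi-split group over ℝ*, Compositio Math. 39 (1979), Lemma 4.3 p. 25.
-/

set_option autoImplicit false

noncomputable section

namespace Literature.NumberTheory.Automorphic.UnitaryGroup

open _root_.MeasureTheory Set Filter _root_.Topology _root_.Complex
open Literature.NumberTheory.Automorphic.Shelstad1979.StableOrbitalIntegrals
open scoped Real MatrixGroups

variable {E : Type*} [NormedAddCommGroup E] [NormedSpace ℝ E]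

/-! ## §1 Bookkeeping -/

/-- The circle torus lies in every diagonal unitary group `U(σ, (diag a).map σ)` (public twin of ★ (R1G)'s private lemma, so that consumers can spell the torus point).
[cite: PlatonovRapinchuk1994, §2.3] -/
theorem circleDiagonal_mem_unitaryGroupOfForm_diagonal_map_weights {L : Type*} [CommRing L] (σ : L →+* ℂ)
    (a : Fin 2 → L) (w : Fin 2 → Circle) :
    circleDiagonal 2 w ∈ unitaryGroupOfForm (starRingEnd ℂ) ((Matrix.diagonal a).map σ) := by
  rw [Matrix.diagonal_map (map_zero σ)]
  exact circleDiagonal_mem_unitaryGroupOfForm_diagonal 2 w _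

/-- `U(σ, −H) = U(σ, H)`. [folklore] -/
private theorem unitaryGroupOfForm_neg_eq' (H : Matrix (Fin 2) (Fin 2) ℂ) :
    unitaryGroupOfForm (starRingEnd ℂ) (-H) = unitaryGroupOfForm (starRingEnd ℂ) H := by
  ext g; rw [mem_unitaryGroupOfForm_iff, mem_unitaryGroupOfForm_iff, Matrix.mul_neg, Matrix.neg_mul, neg_inj]

/-- A diagonal `T ∈ GL₂(ℂ)` commutes with the circle torus. [folklore] -/
private theorem diagonal_mul_circleDiagonal_comm' (T : GL (Fin 2) ℂ) (d : Fin 2 → ℂ)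
    (hTd : (T : Matrix (Fin 2) (Fin 2) ℂ) = Matrix.diagonal d) (w : Fin 2 → Circle) :
    T * circleDiagonal 2 w = circleDiagonal 2 w * T := by
  apply Units.ext; simp only [Units.val_mul, coe_circleDiagonal, hTd, Matrix.diagonal_mul_diagonal]; congr 1; funext i; ring

omit [NormedSpace ℝ E] in
/-- `X ↦ f(A X B)` with `AB = 1` is continuous with compact support when `f` is (`Ad` is a homeomorphism of `M₂(ℂ)`). [folklore] -/
private theorem continuous_hasCompactSupport_comp_conj'' (A B : Matrix (Fin 2) (Fin 2) ℂ) (hAB : A * B = 1) (hBA : B * A = 1)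
    {f : Matrix (Fin 2) (Fin 2) ℂ → E} (hf : Continuous f) (hfc : HasCompactSupport f) :
    Continuous (fun X : Matrix (Fin 2) (Fin 2) ℂ => f (A * X * B)) ∧ HasCompactSupport (fun X : Matrix (Fin 2) (Fin 2) ℂ => f (A * X * B)) := by
  -- adapted from ★ (R1G) `ArchRankOneLimitFormulaGroup` (private `contDiff_hasCompactSupport_comp_conj`)
  refine ⟨hf.comp ((continuous_const.mul continuous_id).mul continuous_const), ?_⟩
  let φ : Matrix (Fin 2) (Fin 2) ℂ ≃ₜ Matrix (Fin 2) (Fin 2) ℂ :=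
    { toFun := fun X => A * X * B
      invFun := fun X => B * X * A
      left_inv := fun X => by
        show B * (A * X * B) * A = X
        rw [← Matrix.mul_assoc, ← Matrix.mul_assoc, hBA, Matrix.one_mul, Matrix.mul_assoc, hBA, Matrix.mul_one]
      right_inv := fun X => by
        show A * (B * X * A) * B = X
        rw [← Matrix.mul_assoc, ← Matrix.mul_assoc, hAB, Matrix.one_mul, Matrix.mul_assoc, hAB, Matrix.mul_one]
      continuous_toFun := (continuous_const.mul continuous_id).mul continuous_const
      continuous_invFun := (continuous_const.mul continuous_id).mul continuous_const }
  exact hfc.comp_homeomorph φ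

/-! ## §2 The frame core: a diagonal congruence to the standard group -/

/-- **Core (diagonal congruence), order 0.**  If `σ(T)ᵀ J T = H` for a DIAGONAL `T ∈ GL₂(ℂ)` (`↑T = Tm`, `↑T⁻¹ = Ti`) and `U(J) = U(diag(1,−1))` as subgroups, then for every Haar `μ₂`
on `U(H)` there is ONE `C₁ > 0` with, for every continuous compactly supported `f` and `z ∈ S¹`: `2 sin ψ · ∫_{U(H)} f(h·diag(z e^{iψ}, z e^{−iψ})·h⁻¹) dμ₂ → C₁ • ∫ f(Ti·(half-cone⁺)·Tm)`
(`ψ → 0⁺`) and `→ C₁ • −∫ f(Ti·(half-cone⁻)·Tm)` (`ψ → 0⁻`) — ★ (K0±)-U11 transported along `h′ ↦ T h′ T⁻¹` (★ `unitaryGroupOfFormCongrOfEq`; the torus is FIXED because `T` is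
diagonal; Haar pushed forward; test function `X ↦ f(Ti X Tm)`; ★ `integral_comp_conj_transport`). [cite: Varadarajan1989, §6.4 Lemma 21 (c), Thm 23] [cite: PlatonovRapinchuk1994, §2.3] -/
theorem tendsto_two_sin_smul_orbitalIntegral_nhdsGT_nhdsLT_of_formCongr (J H : Matrix (Fin 2) (Fin 2) ℂ) (T : GL (Fin 2) ℂ) (d : Fin 2 → ℂ)
    (Tm Ti : Matrix (Fin 2) (Fin 2) ℂ) (hTm : (T : Matrix (Fin 2) (Fin 2) ℂ) = Tm) (hTi : ((T⁻¹ : GL (Fin 2) ℂ) : Matrix (Fin 2) (Fin 2) ℂ) = Ti)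
    (hTd : (T : Matrix (Fin 2) (Fin 2) ℂ) = Matrix.diagonal d) (hTJ : formCongr (starRingEnd ℂ) T J = H)
    (hJ : unitaryGroupOfForm (starRingEnd ℂ) J = unitaryGroupOfForm (starRingEnd ℂ) (Matrix.diagonal ![(1 : ℂ), -1]))
    (hSH : ∀ w : Fin 2 → Circle, circleDiagonal 2 w ∈ unitaryGroupOfForm (starRingEnd ℂ) H)
    [MeasurableSpace ↥(unitaryGroupOfForm (starRingEnd ℂ) H)] [BorelSpace ↥(unitaryGroupOfForm (starRingEnd ℂ) H)]
    (μ₂ : Measure ↥(unitaryGroupOfForm (starRingEnd ℂ) H)) [μ₂.IsHaarMeasure] :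
    ∃ C₁ : ℝ, 0 < C₁ ∧
      ∀ (f : Matrix (Fin 2) (Fin 2) ℂ → E), Continuous f → HasCompactSupport f → ∀ z : Circle,
        Tendsto (fun ψ : ℝ => (2 * Real.sin ψ) •
            ∫ h : ↥(unitaryGroupOfForm (starRingEnd ℂ) H),
              f (((h * ⟨circleDiagonal 2 ![z * Circle.exp ψ, z * Circle.exp (-ψ)], hSH _⟩ * h⁻¹ : ↥(unitaryGroupOfForm (starRingEnd ℂ) H)) :
                GL (Fin 2) ℂ) : Matrix (Fin 2) (Fin 2) ℂ) ∂μ₂)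
          (𝓝[>] 0)
          (𝓝 (C₁ • ∫ p in Ioi (0 : ℝ) ×ˢ Ioc (0 : ℝ) (2 * π),
            f (Ti * ((z : ℂ) • (1 : Matrix (Fin 2) (Fin 2) ℂ) + p.1 • Matrix.diagonal ![(z : ℂ) * I, -((z : ℂ) * I)] +
              p.1 • !![(0 : ℂ), -((z : ℂ) * I) * cexp (-((p.2 : ℂ) * I)); ((z : ℂ) * I) * cexp ((p.2 : ℂ) * I), 0]) * Tm))) ∧
        Tendsto (fun ψ : ℝ => (2 * Real.sin ψ) •
            ∫ h : ↥(unitaryGroupOfForm (starRingEnd ℂ) H),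
              f (((h * ⟨circleDiagonal 2 ![z * Circle.exp ψ, z * Circle.exp (-ψ)], hSH _⟩ * h⁻¹ : ↥(unitaryGroupOfForm (starRingEnd ℂ) H)) :
                GL (Fin 2) ℂ) : Matrix (Fin 2) (Fin 2) ℂ) ∂μ₂)
          (𝓝[<] 0)
          (𝓝 (C₁ • -(∫ p in Ioi (0 : ℝ) ×ˢ Ioc (0 : ℝ) (2 * π),
            f (Ti * ((z : ℂ) • (1 : Matrix (Fin 2) (Fin 2) ℂ) + p.1 • Matrix.diagonal ![-((z : ℂ) * I), (z : ℂ) * I] +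
              p.1 • !![(0 : ℂ), ((z : ℂ) * I) * cexp (-((p.2 : ℂ) * I)); -((z : ℂ) * I) * cexp ((p.2 : ℂ) * I), 0]) * Tm)))) := by
  -- the torus in `U(J)`
  have hSJ : ∀ w : Fin 2 → Circle, circleDiagonal 2 w ∈ unitaryGroupOfForm (starRingEnd ℂ) J := by
    rw [hJ]; exact fun w => circleDiagonal_mem_unitaryGroupOfForm_diagonal 2 w _
  letI : MeasurableSpace ↥(unitaryGroupOfForm (starRingEnd ℂ) J) := borel _
  haveI : BorelSpace ↥(unitaryGroupOfForm (starRingEnd ℂ) J) := ⟨rfl⟩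
  -- the congruence `e : U(H) ≃ₜ* U(J)`, `h′ ↦ T h′ T⁻¹` (kept opaque)
  obtain ⟨e, he⟩ : ∃ e : ↥(unitaryGroupOfForm (starRingEnd ℂ) H) ≃ₜ* ↥(unitaryGroupOfForm (starRingEnd ℂ) J),
      ∀ h' : ↥(unitaryGroupOfForm (starRingEnd ℂ) H), ((e h' : ↥(unitaryGroupOfForm (starRingEnd ℂ) J)) : GL (Fin 2) ℂ) = T * (h' : GL (Fin 2) ℂ) * T⁻¹ :=
    ⟨unitaryGroupOfFormCongrOfEq (starRingEnd ℂ) T J H hTJ, fun _ => rfl⟩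
  -- ★ (K0±)-U11 on `U(J) = U(diag(1,−1))` at the pushed-forward Haar measure
  obtain ⟨C₁, hC₁, hlim⟩ := tendsto_std_of_eq (E := E) J hJ hSJ (μ₂.map e)
  refine ⟨C₁, hC₁, fun f hf hfc z => ?_⟩
  -- the transported test function `X ↦ f(Ti X Tm)`
  have hTT : Ti * Tm = 1 := by rw [← hTi, ← hTm, ← Units.val_mul, inv_mul_cancel, Units.val_one]
  have hTT' : Tm * Ti = 1 := by rw [← hTi, ← hTm, ← Units.val_mul, mul_inv_cancel, Units.val_one]
  obtain ⟨hfT, hfTc⟩ := continuous_hasCompactSupport_comp_conj'' (E := E) Ti Tm hTT hTT' hf hfc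
  obtain ⟨hGT, hLT⟩ := hlim _ hfT hfTc z
  -- the torus is fixed by the diagonal congruence
  have hγ : ∀ ψ : ℝ, e ⟨circleDiagonal 2 ![z * Circle.exp ψ, z * Circle.exp (-ψ)], hSH _⟩ =
      (⟨circleDiagonal 2 ![z * Circle.exp ψ, z * Circle.exp (-ψ)], hSJ _⟩ : ↥(unitaryGroupOfForm (starRingEnd ℂ) J)) := fun ψ => by
    apply Subtype.ext
    rw [he ⟨circleDiagonal 2 ![z * Circle.exp ψ, z * Circle.exp (-ψ)], hSH _⟩]
    show T * circleDiagonal 2 ![z * Circle.exp ψ, z * Circle.exp (-ψ)] * T⁻¹ = circleDiagonal 2 ![z * Circle.exp ψ, z * Circle.exp (-ψ)]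
    rw [diagonal_mul_circleDiagonal_comm' T d hTd, mul_inv_cancel_right]
  -- the measure: `(μ₂.map e).map e⁻¹ = μ₂`
  have hmap : (μ₂.map e).map e.symm = μ₂ := by
    rw [show (Measure.map (⇑e) μ₂ : Measure ↥(unitaryGroupOfForm (starRingEnd ℂ) J)) = Measure.map (⇑e.toHomeomorph.toMeasurableEquiv) μ₂ from rfl,
      show (⇑e.symm) = ⇑e.toHomeomorph.toMeasurableEquiv.symm from rfl, MeasurableEquiv.map_symm_map]
  -- cancellation `Ti (Tm X Ti) Tm = X`
  have hcancel : ∀ X : Matrix (Fin 2) (Fin 2) ℂ, Ti * (Tm * X * Ti) * Tm = X := fun X => by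
    simp only [← Matrix.mul_assoc]
    rw [hTT, Matrix.one_mul, Matrix.mul_assoc, hTT, Matrix.mul_one]
  -- the two functions of `ψ` agree
  have key : ∀ ψ : ℝ, (2 * Real.sin ψ) •
      ∫ h' : ↥(unitaryGroupOfForm (starRingEnd ℂ) H),
        f (((h' * ⟨circleDiagonal 2 ![z * Circle.exp ψ, z * Circle.exp (-ψ)], hSH _⟩ * h'⁻¹ : ↥(unitaryGroupOfForm (starRingEnd ℂ) H)) :
          GL (Fin 2) ℂ) : Matrix (Fin 2) (Fin 2) ℂ) ∂μ₂ =
      (2 * Real.sin ψ) •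
        ∫ h : ↥(unitaryGroupOfForm (starRingEnd ℂ) J), (fun X : Matrix (Fin 2) (Fin 2) ℂ => f (Ti * X * Tm))
          (((h * ⟨circleDiagonal 2 ![z * Circle.exp ψ, z * Circle.exp (-ψ)], hSJ _⟩ * h⁻¹ : ↥(unitaryGroupOfForm (starRingEnd ℂ) J)) :
            GL (Fin 2) ℂ) : Matrix (Fin 2) (Fin 2) ℂ) ∂(μ₂.map e) := fun ψ => by
    have htr := integral_comp_conj_transport (E := E) _ _ e T he (μ₂.map e) (fun X : Matrix (Fin 2) (Fin 2) ℂ => f (Ti * X * Tm))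
      ⟨circleDiagonal 2 ![z * Circle.exp ψ, z * Circle.exp (-ψ)], hSH _⟩
    rw [hγ ψ, hmap, hTm, hTi] at htr
    rw [htr]
    congr 1
    refine integral_congr_ae (Eventually.of_forall fun h' => ?_)
    simp only []
    rw [hcancel]
  exact ⟨hGT.congr fun ψ => (key ψ).symm, hLT.congr fun ψ => (key ψ).symm⟩

/-! ## §3 The head on `U(σ, diag(σ a))`, `re σ(a₀) · re σ(a₁) < 0` -/

/-- **(K0±)-U11 ON THE GROUP `U(e₀, e₁)`, `e₀e₁ < 0` — THE ONE-SIDED VALUES (general real weights).**  Let `σ : L → ℂ`, `a : Fin 2 → L` with `σ(a₀), σ(a₁)` real of opposite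
signs, `G₂ = U(σ, diag(σ a)) ≅ U(1,1)` (★ (R1G)'s carrier), `μ₂` any Haar measure on `G₂`.  Then there is ONE `C₁ > 0` (depending on `μ₂` only) such that for every continuous compactly
supported `f : M₂(ℂ) → E` and every `z ∈ S¹`, with `T = diag(√|e₀|, √|e₁|)`, `e_i = re σ(a_i)`:
`2 sin ψ · ∫_{G₂} f(h·diag(z e^{iψ}, z e^{−iψ})·h⁻¹) dμ₂(h) → C₁ • ∫_{τ>0, θ∈(0,2π]} f(T⁻¹·(z·1 + τ·diag(iz,−iz) + τ·(0, −iz e^{−iθ}; iz e^{iθ}, 0))·T) dτ dθ` as `ψ → 0⁺` and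
`→ C₁ • −∫ f(T⁻¹·(z·1 + τ·diag(−iz,iz) + τ·(0, iz e^{−iθ}; −iz e^{iθ}, 0))·T)` as `ψ → 0⁻` — the order-0 companion of ★ (R1G) `exists_tendsto_deriv_two_sin_smul_orbitalIntegral`, the shape the
`G′`-side descent (J-DESC) reads on the `U(1,1)`-block `U(σ_w diag(α_i, α_j))` of `G′_s`. [cite: Varadarajan1989, §6.4 Lemma 21 (c), Thm 23] [cite: Rogawski1990, §8.2 p. 119] -/
theorem exists_tendsto_two_sin_smul_orbitalIntegral_nhdsGT_nhdsLT_weights {L : Type*} [CommRing L] (σ : L →+* ℂ) (a : Fin 2 → L)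
    (hreal : ∀ i, (σ (a i)).im = 0) (hsgn : (σ (a 0)).re * (σ (a 1)).re < 0)
    [MeasurableSpace ↥(unitaryGroupOfForm (starRingEnd ℂ) ((Matrix.diagonal a).map σ))] [BorelSpace ↥(unitaryGroupOfForm (starRingEnd ℂ) ((Matrix.diagonal a).map σ))]
    (μ₂ : Measure ↥(unitaryGroupOfForm (starRingEnd ℂ) ((Matrix.diagonal a).map σ))) [μ₂.IsHaarMeasure] :
    ∃ C₁ : ℝ, 0 < C₁ ∧
      ∀ (f : Matrix (Fin 2) (Fin 2) ℂ → E), Continuous f → HasCompactSupport f → ∀ z : Circle,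
        Tendsto (fun ψ : ℝ => (2 * Real.sin ψ) •
            ∫ h : ↥(unitaryGroupOfForm (starRingEnd ℂ) ((Matrix.diagonal a).map σ)),
              f (((h * ⟨circleDiagonal 2 ![z * Circle.exp ψ, z * Circle.exp (-ψ)], circleDiagonal_mem_unitaryGroupOfForm_diagonal_map_weights σ a _⟩ * h⁻¹ :
                ↥(unitaryGroupOfForm (starRingEnd ℂ) ((Matrix.diagonal a).map σ))) : GL (Fin 2) ℂ) : Matrix (Fin 2) (Fin 2) ℂ) ∂μ₂)
          (𝓝[>] 0)
          (𝓝 (C₁ • ∫ p in Ioi (0 : ℝ) ×ˢ Ioc (0 : ℝ) (2 * π),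
            f (Matrix.diagonal ![(((Real.sqrt |(σ (a 0)).re|)⁻¹ : ℝ) : ℂ), (((Real.sqrt |(σ (a 1)).re|)⁻¹ : ℝ) : ℂ)] *
              ((z : ℂ) • (1 : Matrix (Fin 2) (Fin 2) ℂ) + p.1 • Matrix.diagonal ![(z : ℂ) * I, -((z : ℂ) * I)] +
                p.1 • !![(0 : ℂ), -((z : ℂ) * I) * cexp (-((p.2 : ℂ) * I)); ((z : ℂ) * I) * cexp ((p.2 : ℂ) * I), 0]) *
              Matrix.diagonal ![((Real.sqrt |(σ (a 0)).re| : ℝ) : ℂ), ((Real.sqrt |(σ (a 1)).re| : ℝ) : ℂ)]))) ∧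
        Tendsto (fun ψ : ℝ => (2 * Real.sin ψ) •
            ∫ h : ↥(unitaryGroupOfForm (starRingEnd ℂ) ((Matrix.diagonal a).map σ)),
              f (((h * ⟨circleDiagonal 2 ![z * Circle.exp ψ, z * Circle.exp (-ψ)], circleDiagonal_mem_unitaryGroupOfForm_diagonal_map_weights σ a _⟩ * h⁻¹ :
                ↥(unitaryGroupOfForm (starRingEnd ℂ) ((Matrix.diagonal a).map σ))) : GL (Fin 2) ℂ) : Matrix (Fin 2) (Fin 2) ℂ) ∂μ₂)
          (𝓝[<] 0)
          (𝓝 (C₁ • -(∫ p in Ioi (0 : ℝ) ×ˢ Ioc (0 : ℝ) (2 * π),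
            f (Matrix.diagonal ![(((Real.sqrt |(σ (a 0)).re|)⁻¹ : ℝ) : ℂ), (((Real.sqrt |(σ (a 1)).re|)⁻¹ : ℝ) : ℂ)] *
              ((z : ℂ) • (1 : Matrix (Fin 2) (Fin 2) ℂ) + p.1 • Matrix.diagonal ![-((z : ℂ) * I), (z : ℂ) * I] +
                p.1 • !![(0 : ℂ), ((z : ℂ) * I) * cexp (-((p.2 : ℂ) * I)); -((z : ℂ) * I) * cexp ((p.2 : ℂ) * I), 0]) *
              Matrix.diagonal ![((Real.sqrt |(σ (a 0)).re| : ℝ) : ℂ), ((Real.sqrt |(σ (a 1)).re| : ℝ) : ℂ)])))) := by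
  -- adapted from ★ (R1G) `exists_tendsto_deriv_two_sin_smul_orbitalIntegral_of_chart_identity` (the sign split and the diagonal congruence)
  set e₀ : ℝ := (σ (a 0)).re with he₀
  set e₁ : ℝ := (σ (a 1)).re with he₁
  have hH : (Matrix.diagonal a).map σ = Matrix.diagonal ![(e₀ : ℂ), (e₁ : ℂ)] := by
    rw [Matrix.diagonal_map (map_zero σ)]
    congr 1; funext i
    fin_cases i
    · exact Complex.ext (by simp [he₀]) (by simp [hreal 0])
    · exact Complex.ext (by simp [he₁]) (by simp [hreal 1])
  have he₀0 : e₀ ≠ 0 := fun h => by rw [h, zero_mul] at hsgn; exact lt_irrefl _ hsgn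
  have he₁0 : e₁ ≠ 0 := fun h => by rw [h, mul_zero] at hsgn; exact lt_irrefl _ hsgn
  have hs₀ : 0 < Real.sqrt |e₀| := Real.sqrt_pos.2 (abs_pos.2 he₀0)
  have hs₁ : 0 < Real.sqrt |e₁| := Real.sqrt_pos.2 (abs_pos.2 he₁0)
  -- the frame `T = diag(√|e₀|, √|e₁|)` and its inverse
  have hdet : (Matrix.diagonal ![((Real.sqrt |e₀| : ℝ) : ℂ), ((Real.sqrt |e₁| : ℝ) : ℂ)]).det ≠ 0 := by
    rw [Matrix.det_diagonal, Fin.prod_univ_two]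
    simp only [Matrix.cons_val_zero, Matrix.cons_val_one]
    exact mul_ne_zero (by exact_mod_cast hs₀.ne') (by exact_mod_cast hs₁.ne')
  set T : GL (Fin 2) ℂ := Matrix.GeneralLinearGroup.mkOfDetNeZero _ hdet with hTdef
  have hT : (T : Matrix (Fin 2) (Fin 2) ℂ) = Matrix.diagonal ![((Real.sqrt |e₀| : ℝ) : ℂ), ((Real.sqrt |e₁| : ℝ) : ℂ)] := by
    rw [hTdef, Matrix.GeneralLinearGroup.val_mkOfDetNeZero]
  have hTi : ((T⁻¹ : GL (Fin 2) ℂ) : Matrix (Fin 2) (Fin 2) ℂ) =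
      Matrix.diagonal ![(((Real.sqrt |e₀|)⁻¹ : ℝ) : ℂ), (((Real.sqrt |e₁|)⁻¹ : ℝ) : ℂ)] := by
    rw [Matrix.GeneralLinearGroup.coe_inv, hT]
    refine Matrix.inv_eq_left_inv ?_
    rw [Matrix.diagonal_mul_diagonal, ← Matrix.diagonal_one]
    congr 1; funext i
    fin_cases i
    · show (((Real.sqrt |e₀|)⁻¹ : ℝ) : ℂ) * ((Real.sqrt |e₀| : ℝ) : ℂ) = 1
      exact_mod_cast inv_mul_cancel₀ hs₀.ne'
    · show (((Real.sqrt |e₁|)⁻¹ : ℝ) : ℂ) * ((Real.sqrt |e₁| : ℝ) : ℂ) = 1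
      exact_mod_cast inv_mul_cancel₀ hs₁.ne'
  -- the sign of `e₀` decides which standard form `J = ±diag(1,−1)` is congruent to `H`
  rcases lt_or_gt_of_ne he₀0 with hneg | hpos
  · -- `e₀ < 0 < e₁`: `J = diag(−1, 1) = −diag(1,−1)`
    have he₁ : 0 < e₁ := by nlinarith
    have hJ : unitaryGroupOfForm (starRingEnd ℂ) (Matrix.diagonal ![(-1 : ℂ), 1]) =
        unitaryGroupOfForm (starRingEnd ℂ) (Matrix.diagonal ![(1 : ℂ), -1]) := by
      rw [← unitaryGroupOfForm_neg_eq']; congr 1; ext i j; fin_cases i <;> fin_cases j <;> simp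
    have hTJ : formCongr (starRingEnd ℂ) T (Matrix.diagonal ![(-1 : ℂ), 1]) = (Matrix.diagonal a).map σ := by
      rw [hH, formCongr, hT]
      have h0 : ((Real.sqrt |e₀| : ℝ) : ℂ) * ((Real.sqrt |e₀| : ℝ) : ℂ) = -(e₀ : ℂ) := by
        rw [← Complex.ofReal_mul, Real.mul_self_sqrt (abs_nonneg _), abs_of_neg hneg]; push_cast; ring
      have h1 : ((Real.sqrt |e₁| : ℝ) : ℂ) * ((Real.sqrt |e₁| : ℝ) : ℂ) = (e₁ : ℂ) := by
        rw [← Complex.ofReal_mul, Real.mul_self_sqrt (abs_nonneg _), abs_of_pos he₁]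
      ext i j
      fin_cases i <;> fin_cases j <;>
        simp [Matrix.diagonal_map, Matrix.diagonal_transpose, Matrix.diagonal_mul_diagonal, Complex.conj_ofReal, h0, h1]
    exact tendsto_two_sin_smul_orbitalIntegral_nhdsGT_nhdsLT_of_formCongr (E := E) _ _ T _ _ _ hT hTi hT hTJ hJ
      (circleDiagonal_mem_unitaryGroupOfForm_diagonal_map_weights σ a) μ₂
  · -- `e₀ > 0 > e₁`: `J = diag(1,−1)`
    have he₁ : e₁ < 0 := by nlinarith
    have hTJ : formCongr (starRingEnd ℂ) T (Matrix.diagonal ![(1 : ℂ), -1]) = (Matrix.diagonal a).map σ := by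
      rw [hH, formCongr, hT]
      have h0 : ((Real.sqrt |e₀| : ℝ) : ℂ) * ((Real.sqrt |e₀| : ℝ) : ℂ) = (e₀ : ℂ) := by
        rw [← Complex.ofReal_mul, Real.mul_self_sqrt (abs_nonneg _), abs_of_pos hpos]
      have h1 : ((Real.sqrt |e₁| : ℝ) : ℂ) * ((Real.sqrt |e₁| : ℝ) : ℂ) = -(e₁ : ℂ) := by
        rw [← Complex.ofReal_mul, Real.mul_self_sqrt (abs_nonneg _), abs_of_neg he₁]; push_cast; ring
      ext i j
      fin_cases i <;> fin_cases j <;>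
        simp [Matrix.diagonal_map, Matrix.diagonal_transpose, Matrix.diagonal_mul_diagonal, Complex.conj_ofReal, h0, h1]
    exact tendsto_two_sin_smul_orbitalIntegral_nhdsGT_nhdsLT_of_formCongr (E := E) _ _ T _ _ _ hT hTi hT hTJ rfl
      (circleDiagonal_mem_unitaryGroupOfForm_diagonal_map_weights σ a) μ₂

/-- **THE ORDER-0 JUMP ON `U(e₀,e₁)`** (`E = ℂ`, ★ `HasOneSidedJump` currency): one `C₁ > 0` per Haar `μ₂` such that for every continuous compactly supported `f : M₂(ℂ) → ℂ` and
`z ∈ S¹`, `ψ ↦ 2 sin ψ · ∫_{U(e₀,e₁)} f(h·diag(z e^{iψ}, z e^{−iψ})·h⁻¹) dμ₂` has both one-sided limits at `ψ = 0` and jumps by `C₁ ·` (the integral of `f` over `T⁻¹·(nilpotent cone at z·1)·T`,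
both nappes, `T = diag(√|e₀|, √|e₁|)`). [cite: Shelstad1979, Lemma 4.3 p. 25] [cite: Varadarajan1989, §6.4 Thm 23] [cite: Rogawski1990, §8.2 p. 119] -/
theorem exists_hasOneSidedJump_two_sin_mul_orbitalIntegral_weights {L : Type*} [CommRing L] (σ : L →+* ℂ) (a : Fin 2 → L)
    (hreal : ∀ i, (σ (a i)).im = 0) (hsgn : (σ (a 0)).re * (σ (a 1)).re < 0)
    [MeasurableSpace ↥(unitaryGroupOfForm (starRingEnd ℂ) ((Matrix.diagonal a).map σ))] [BorelSpace ↥(unitaryGroupOfForm (starRingEnd ℂ) ((Matrix.diagonal a).map σ))]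
    (μ₂ : Measure ↥(unitaryGroupOfForm (starRingEnd ℂ) ((Matrix.diagonal a).map σ))) [μ₂.IsHaarMeasure] :
    ∃ C₁ : ℝ, 0 < C₁ ∧
      ∀ (f : Matrix (Fin 2) (Fin 2) ℂ → ℂ), Continuous f → HasCompactSupport f → ∀ z : Circle,
        HasOneSidedJump (fun ψ : ℝ => (2 * Real.sin ψ : ℂ) *
            ∫ h : ↥(unitaryGroupOfForm (starRingEnd ℂ) ((Matrix.diagonal a).map σ)),
              f (((h * ⟨circleDiagonal 2 ![z * Circle.exp ψ, z * Circle.exp (-ψ)], circleDiagonal_mem_unitaryGroupOfForm_diagonal_map_weights σ a _⟩ * h⁻¹ :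
                ↥(unitaryGroupOfForm (starRingEnd ℂ) ((Matrix.diagonal a).map σ))) : GL (Fin 2) ℂ) : Matrix (Fin 2) (Fin 2) ℂ) ∂μ₂)
          ((C₁ : ℂ) * ((∫ p in Ioi (0 : ℝ) ×ˢ Ioc (0 : ℝ) (2 * π),
              f (Matrix.diagonal ![(((Real.sqrt |(σ (a 0)).re|)⁻¹ : ℝ) : ℂ), (((Real.sqrt |(σ (a 1)).re|)⁻¹ : ℝ) : ℂ)] *
                ((z : ℂ) • (1 : Matrix (Fin 2) (Fin 2) ℂ) + p.1 • Matrix.diagonal ![(z : ℂ) * I, -((z : ℂ) * I)] +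
                  p.1 • !![(0 : ℂ), -((z : ℂ) * I) * cexp (-((p.2 : ℂ) * I)); ((z : ℂ) * I) * cexp ((p.2 : ℂ) * I), 0]) *
                Matrix.diagonal ![((Real.sqrt |(σ (a 0)).re| : ℝ) : ℂ), ((Real.sqrt |(σ (a 1)).re| : ℝ) : ℂ)])) +
            ∫ p in Ioi (0 : ℝ) ×ˢ Ioc (0 : ℝ) (2 * π),
              f (Matrix.diagonal ![(((Real.sqrt |(σ (a 0)).re|)⁻¹ : ℝ) : ℂ), (((Real.sqrt |(σ (a 1)).re|)⁻¹ : ℝ) : ℂ)] *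
                ((z : ℂ) • (1 : Matrix (Fin 2) (Fin 2) ℂ) + p.1 • Matrix.diagonal ![-((z : ℂ) * I), (z : ℂ) * I] +
                  p.1 • !![(0 : ℂ), ((z : ℂ) * I) * cexp (-((p.2 : ℂ) * I)); -((z : ℂ) * I) * cexp ((p.2 : ℂ) * I), 0]) *
                Matrix.diagonal ![((Real.sqrt |(σ (a 0)).re| : ℝ) : ℂ), ((Real.sqrt |(σ (a 1)).re| : ℝ) : ℂ)]))) := by
  obtain ⟨C₁, hC₁, h⟩ := exists_tendsto_two_sin_smul_orbitalIntegral_nhdsGT_nhdsLT_weights (E := ℂ) σ a hreal hsgn μ₂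
  refine ⟨C₁, hC₁, fun f hf hfc z => ?_⟩
  obtain ⟨hp, hm⟩ := h f hf hfc z
  have hsmul : ∀ (ψ : ℝ) (x : ℂ), (2 * Real.sin ψ) • x = (2 * Real.sin ψ : ℂ) * x := fun ψ x => by
    rw [Complex.real_smul]; push_cast; ring
  refine ⟨_, _, hp.congr fun ψ => hsmul ψ _, hm.congr fun ψ => hsmul ψ _, ?_⟩
  rw [Complex.real_smul, Complex.real_smul]
  ring

end Literature.NumberTheory.Automorphic.UnitaryGroup

end
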